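import Mathlib.Algebra.BigOperators.Fin
import Mathlib.Algebra.BigOperators.Ring.Finset
import Mathlib.Algebra.Order.Chebyshev
import Mathlib.Analysis.SpecialFunctions.Pow.Real
import Mathlib.Data.Fin.Tuple.Basic
import HarnessLib

/-!
# A sum of i.i.d. bounded mean-zero terms is non-negative with probability bounded below

Topic `Probability/Moments`; finite probability (weighted `Finset` sums, no measure theory).
Let `p` be a probability weight on a finite type `C` (`p ≥ 0`, `Σ p = 1`) and `Y : C → ℝ` with
`Σ p Y = 0`, `Σ p Y² = v > 0`, `|Y| ≤ K`. For `m` i.i.d. draws `Φ : Fin m → C` (weight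
`∏ᵢ p(Φᵢ)`) and `T = Σᵢ Y(Φᵢ)` we prove, for every `m ≥ 1`,

`P[T ≥ 0] ≥ v / (4 (K² + 3v))` (`sum_prod_ite_sum_nonneg_ge`),

uniformly in `m`. This is the elementary substitute for the central limit theorem in the proof of
Achlioptas–Peres 2004, Lemma 7 (`E[X₊]/E[X] → 1/2`; arXiv:cs/0305009 p. 17: "Since
`Ẽ_γ[H(σ,c)] = 0`, the central limit theorem yields `P̃_γ[H(σ,F) ≥ 0] → 1/2`"), where only a
positive lower bound is needed. Proof: the classical fourth-moment argument
(`P[T ≥ 0] ≥ E[T²]²/(4 E[T⁴])` for mean-zero `T`, via `E|T| ≥ E[T²]^{3/2}/E[T⁴]^{1/2}` and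
`E[T₊]² ≤ E[T²] P[T ≥ 0]`, three applications of Cauchy–Schwarz), together with the exact
moments `E[T] = 0`, `E[T²] = m v`, `E[T⁴] = m μ₄ + 3 m(m-1) v² ≤ m K² v + 3 m² v²` obtained by
peeling off the first draw (`sum_prod_mul_comp_sum_succ`, `Fin.consEquiv`).

## Results (all proved; the functional `g ↦ Σ_Φ (∏ p(Φᵢ)) g(Σ Y(Φᵢ))` is written inline)

* `sum_prod_mul_comp_sum_succ` — peeling: `E_{m+1}[g(T)] = Σ_c p_c E_m[g(Y_c + T)]`;
* `sum_prod_mul_const`, `sum_prod_mul_sum_eq_zero`, `sum_prod_mul_sum_sq`,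
  `sum_prod_mul_sum_pow_four` — `E[a] = a`, `E[T] = 0`, `E[T²] = m v`,
  `E[T⁴] = m μ₄ + 3(m² - m) v²`;
* three weighted Cauchy–Schwarz inequalities (`sq_sum_mul_posPart_le`,
  `sq_sum_mul_sq_le`, `sq_sum_mul_abs_pow_three_le`), the algebra `b² ≤ 4 d q`
  (`sq_le_four_mul_of_moments`), and the bound `P[T ≥ 0] ≥ v/(4(K² + 3v))`
  (`sum_prod_ite_sum_nonneg_ge`).

## References

* B. Berger, *The fourth moment method*, SIAM J. Comput. 26 (1997) 1188–1207, §2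
  (`P[T ≥ 0]`-type lower bounds from `E[T²]`, `E[T⁴]` for mean-zero `T`). (Standard; proved
  here in finite form.)
* D. Achlioptas, Y. Peres, J. Amer. Math. Soc. 17 (2004), Lemma 7 (arXiv:cs/0305009 pp. 15–17)
  — the use. [AchlioptasPeres2004]
-/

noncomputable section

namespace Literature.Probability.Moments

open Finset

variable {C : Type*} [Fintype C]

/-! ### Peeling off the first draw -/

/-- **Peeling the first of `m+1` i.i.d. draws**:
`Σ_{Φ : Fin (m+1) → C} (∏ p(Φᵢ)) g(Σ Y(Φᵢ)) = Σ_c p(c) Σ_{Φ : Fin m → C} (∏ p(Φᵢ)) g(Y(c) + Σ Y(Φᵢ))`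
(`Fin.consEquiv`, `Fin.prod_univ_succ`, `Fin.sum_univ_succ`). [folklore] -/
theorem sum_prod_mul_comp_sum_succ (p Y : C → ℝ) (g : ℝ → ℝ) (m : ℕ) :
    ∑ Φ : Fin (m + 1) → C, (∏ i, p (Φ i)) * g (∑ i, Y (Φ i)) =
      ∑ c, p c * ∑ Φ : Fin m → C, (∏ i, p (Φ i)) * g (Y c + ∑ i, Y (Φ i)) := by
  have h := Fintype.sum_equiv (Fin.consEquiv fun _ : Fin (m + 1) => C)
    (fun x : C × (Fin m → C) =>
      (∏ i, p ((Fin.cons (α := fun _ : Fin (m + 1) => C) x.1 x.2) i)) *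
        g (∑ i, Y ((Fin.cons (α := fun _ : Fin (m + 1) => C) x.1 x.2) i)))
    (fun Φ => (∏ i, p (Φ i)) * g (∑ i, Y (Φ i))) (fun x => rfl)
  rw [← h, Fintype.sum_prod_type]
  refine Finset.sum_congr rfl fun c _ => ?_
  rw [Finset.mul_sum]
  refine Finset.sum_congr rfl fun Φ _ => ?_
  simp only [Fin.prod_univ_succ, Fin.sum_univ_succ, Fin.cons_zero, Fin.cons_succ]
  ring

/-! ### Moments -/

/-- Total mass: `Σ_Φ (∏ p(Φᵢ)) · a = a` when `Σ p = 1`. [folklore] -/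
theorem sum_prod_mul_const {p : C → ℝ} (hp1 : ∑ c, p c = 1) (m : ℕ) (a : ℝ) :
    ∑ Φ : Fin m → C, (∏ i, p (Φ i)) * a = a := by
  rw [← Finset.sum_mul, ← Fintype.sum_pow, hp1, one_pow, one_mul]

/-- Linearity helper: `Σ_Φ (∏ p)(f + g) = Σ_Φ (∏ p) f + Σ_Φ (∏ p) g`. [folklore] -/
theorem sum_prod_mul_add (p : C → ℝ) (m : ℕ) (f g : (Fin m → C) → ℝ) :
    ∑ Φ : Fin m → C, (∏ i, p (Φ i)) * (f Φ + g Φ) =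
      ∑ Φ : Fin m → C, (∏ i, p (Φ i)) * f Φ + ∑ Φ : Fin m → C, (∏ i, p (Φ i)) * g Φ := by
  rw [← Finset.sum_add_distrib]
  refine Finset.sum_congr rfl fun Φ _ => ?_
  ring

/-- Linearity helper: `Σ_Φ (∏ p)(a f) = a Σ_Φ (∏ p) f`. [folklore] -/
theorem sum_prod_mul_smul (p : C → ℝ) (m : ℕ) (a : ℝ) (f : (Fin m → C) → ℝ) :
    ∑ Φ : Fin m → C, (∏ i, p (Φ i)) * (a * f Φ) = a * ∑ Φ : Fin m → C, (∏ i, p (Φ i)) * f Φ := by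
  rw [Finset.mul_sum]
  refine Finset.sum_congr rfl fun Φ _ => ?_
  ring

/-- **Mean zero**: `E[T] = 0` when `Σ p = 1`, `Σ p Y = 0`. [folklore] -/
theorem sum_prod_mul_sum_eq_zero {p Y : C → ℝ} (hp1 : ∑ c, p c = 1)
    (hY1 : ∑ c, p c * Y c = 0) (m : ℕ) :
    ∑ Φ : Fin m → C, (∏ i, p (Φ i)) * (∑ i, Y (Φ i)) = 0 := by
  induction m with
  | zero => simp
  | succ m ih =>
    rw [sum_prod_mul_comp_sum_succ p Y (fun t => t) m]
    have inner : ∀ c, ∑ Φ : Fin m → C, (∏ i, p (Φ i)) * (Y c + ∑ i, Y (Φ i)) = Y c := by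
      intro c
      rw [sum_prod_mul_add, sum_prod_mul_const hp1, ih, add_zero]
    simp only [inner]
    exact hY1

/-- **Second moment**: `E[T²] = m v` when `Σ p = 1`, `Σ p Y = 0`, `Σ p Y² = v`. [folklore] -/
theorem sum_prod_mul_sum_sq {p Y : C → ℝ} (hp1 : ∑ c, p c = 1)
    (hY1 : ∑ c, p c * Y c = 0) {v : ℝ} (hY2 : ∑ c, p c * Y c ^ 2 = v) (m : ℕ) :
    ∑ Φ : Fin m → C, (∏ i, p (Φ i)) * (∑ i, Y (Φ i)) ^ 2 = m * v := by
  induction m with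
  | zero => simp
  | succ m ih =>
    rw [sum_prod_mul_comp_sum_succ p Y (fun t => t ^ 2) m]
    have inner : ∀ c, ∑ Φ : Fin m → C, (∏ i, p (Φ i)) * (Y c + ∑ i, Y (Φ i)) ^ 2 =
        Y c ^ 2 + m * v := by
      intro c
      have e : ∀ Φ : Fin m → C, (Y c + ∑ i, Y (Φ i)) ^ 2 =
          Y c ^ 2 + (2 * Y c * (∑ i, Y (Φ i)) + (∑ i, Y (Φ i)) ^ 2) := fun Φ => by ring
      simp only [e]
      rw [sum_prod_mul_add, sum_prod_mul_const hp1, sum_prod_mul_add, sum_prod_mul_smul,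
        sum_prod_mul_sum_eq_zero hp1 hY1, ih]
      ring
    simp only [inner]
    have e2 : ∀ c, p c * (Y c ^ 2 + m * v) = p c * Y c ^ 2 + (m * v) * p c := fun c => by ring
    rw [Finset.sum_congr rfl fun c _ => e2 c, Finset.sum_add_distrib, ← Finset.mul_sum, hY2, hp1]
    push_cast
    ring

/-- **Fourth moment**: `E[T⁴] = m μ₄ + 3 (m² - m) v²` when `Σ p = 1`, `Σ p Y = 0`, `Σ p Y² = v`,
`Σ p Y⁴ = μ₄` (the cross terms `4 E[Y³] E[T]` and `4 E[Y] E[T³]` vanish). [folklore] -/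
theorem sum_prod_mul_sum_pow_four {p Y : C → ℝ} (hp1 : ∑ c, p c = 1)
    (hY1 : ∑ c, p c * Y c = 0) {v μ₄ : ℝ} (hY2 : ∑ c, p c * Y c ^ 2 = v)
    (hY4 : ∑ c, p c * Y c ^ 4 = μ₄) (m : ℕ) :
    ∑ Φ : Fin m → C, (∏ i, p (Φ i)) * (∑ i, Y (Φ i)) ^ 4 =
      m * μ₄ + 3 * ((m : ℝ) ^ 2 - m) * v ^ 2 := by
  induction m with
  | zero => simp
  | succ m ih =>
    rw [sum_prod_mul_comp_sum_succ p Y (fun t => t ^ 4) m]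
    set M3 : ℝ := ∑ Φ : Fin m → C, (∏ i, p (Φ i)) * (∑ i, Y (Φ i)) ^ 3 with hM3
    set R : ℝ := m * μ₄ + 3 * ((m : ℝ) ^ 2 - m) * v ^ 2 with hR
    have inner : ∀ c, ∑ Φ : Fin m → C, (∏ i, p (Φ i)) * (Y c + ∑ i, Y (Φ i)) ^ 4 =
        Y c ^ 4 + 6 * Y c ^ 2 * (m * v) + 4 * Y c * M3 + R := by
      intro c
      have e : ∀ Φ : Fin m → C, (Y c + ∑ i, Y (Φ i)) ^ 4 =
          Y c ^ 4 + (4 * Y c ^ 3 * (∑ i, Y (Φ i)) + (6 * Y c ^ 2 * (∑ i, Y (Φ i)) ^ 2 +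
            (4 * Y c * (∑ i, Y (Φ i)) ^ 3 + (∑ i, Y (Φ i)) ^ 4))) := fun Φ => by ring
      simp only [e]
      rw [sum_prod_mul_add, sum_prod_mul_const hp1, sum_prod_mul_add, sum_prod_mul_smul,
        sum_prod_mul_sum_eq_zero hp1 hY1, sum_prod_mul_add, sum_prod_mul_smul,
        sum_prod_mul_sum_sq hp1 hY1 hY2, sum_prod_mul_add, sum_prod_mul_smul, ← hM3, ih]
      ring
    simp only [inner]
    have e2 : ∀ c, p c * (Y c ^ 4 + 6 * Y c ^ 2 * (m * v) + 4 * Y c * M3 + R) =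
        p c * Y c ^ 4 + 6 * (m * v) * (p c * Y c ^ 2) + 4 * M3 * (p c * Y c) + R * p c := by
      intro c; ring
    rw [Finset.sum_congr rfl fun c _ => e2 c, Finset.sum_add_distrib, Finset.sum_add_distrib,
      Finset.sum_add_distrib, ← Finset.mul_sum, ← Finset.mul_sum, ← Finset.mul_sum, hY4, hY2,
      hY1, hp1, hR]
    push_cast
    ring

/-! ### Three weighted Cauchy–Schwarz inequalities -/

/-- `(Σ w T 1[T≥0])² ≤ (Σ w T²)(Σ w 1[T≥0])` for weights `w ≥ 0`. [folklore] -/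
theorem sq_sum_mul_posPart_le {ι : Type*} (s : Finset ι) (w T : ι → ℝ) (hw : ∀ i ∈ s, 0 ≤ w i) :
    (∑ i ∈ s, w i * (T i * if 0 ≤ T i then 1 else 0)) ^ 2 ≤
      (∑ i ∈ s, w i * T i ^ 2) * ∑ i ∈ s, w i * (if 0 ≤ T i then 1 else 0) := by
  have cs := Finset.sum_mul_sq_le_sq_mul_sq s (fun i => Real.sqrt (w i) * T i)
    (fun i => Real.sqrt (w i) * (if 0 ≤ T i then 1 else 0))
  have e1 : ∀ i ∈ s, Real.sqrt (w i) * T i * (Real.sqrt (w i) * (if 0 ≤ T i then 1 else 0)) =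
      w i * (T i * if 0 ≤ T i then 1 else 0) := by
    intro i hi
    have hs := Real.mul_self_sqrt (hw i hi)
    calc Real.sqrt (w i) * T i * (Real.sqrt (w i) * (if 0 ≤ T i then 1 else 0))
        = (Real.sqrt (w i) * Real.sqrt (w i)) * (T i * if 0 ≤ T i then 1 else 0) := by ring
      _ = _ := by rw [hs]
  have e2 : ∀ i ∈ s, (Real.sqrt (w i) * T i) ^ 2 = w i * T i ^ 2 := by
    intro i hi; rw [mul_pow, Real.sq_sqrt (hw i hi)]
  have e3 : ∀ i ∈ s, (Real.sqrt (w i) * (if 0 ≤ T i then 1 else 0)) ^ 2 =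
      w i * (if 0 ≤ T i then 1 else 0) := by
    intro i hi; rw [mul_pow, Real.sq_sqrt (hw i hi)]; split_ifs <;> ring
  rw [Finset.sum_congr rfl e1, Finset.sum_congr rfl e2, Finset.sum_congr rfl e3] at cs
  exact cs

/-- `(Σ w T²)² ≤ (Σ w |T|)(Σ w |T|³)` for weights `w ≥ 0`. [folklore] -/
theorem sq_sum_mul_sq_le {ι : Type*} (s : Finset ι) (w T : ι → ℝ) (hw : ∀ i ∈ s, 0 ≤ w i) :
    (∑ i ∈ s, w i * T i ^ 2) ^ 2 ≤ (∑ i ∈ s, w i * |T i|) * ∑ i ∈ s, w i * |T i| ^ 3 := by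
  have cs := Finset.sum_mul_sq_le_sq_mul_sq s (fun i => Real.sqrt (w i * |T i|))
    (fun i => Real.sqrt (w i * |T i|) * |T i|)
  have hwT : ∀ i ∈ s, 0 ≤ w i * |T i| := fun i hi => mul_nonneg (hw i hi) (abs_nonneg _)
  have e1 : ∀ i ∈ s, Real.sqrt (w i * |T i|) * (Real.sqrt (w i * |T i|) * |T i|) = w i * T i ^ 2 := by
    intro i hi
    rw [← mul_assoc, Real.mul_self_sqrt (hwT i hi), mul_assoc, ← sq_abs (T i), sq]
  have e2 : ∀ i ∈ s, Real.sqrt (w i * |T i|) ^ 2 = w i * |T i| := fun i hi => Real.sq_sqrt (hwT i hi)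
  have e3 : ∀ i ∈ s, (Real.sqrt (w i * |T i|) * |T i|) ^ 2 = w i * |T i| ^ 3 := by
    intro i hi; rw [mul_pow, Real.sq_sqrt (hwT i hi)]; ring
  rw [Finset.sum_congr rfl e1, Finset.sum_congr rfl e2, Finset.sum_congr rfl e3] at cs
  exact cs

/-- `(Σ w |T|³)² ≤ (Σ w T²)(Σ w T⁴)` for weights `w ≥ 0`. [folklore] -/
theorem sq_sum_mul_abs_pow_three_le {ι : Type*} (s : Finset ι) (w T : ι → ℝ)
    (hw : ∀ i ∈ s, 0 ≤ w i) :
    (∑ i ∈ s, w i * |T i| ^ 3) ^ 2 ≤ (∑ i ∈ s, w i * T i ^ 2) * ∑ i ∈ s, w i * T i ^ 4 := by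
  have cs := Finset.sum_mul_sq_le_sq_mul_sq s (fun i => Real.sqrt (w i) * |T i|)
    (fun i => Real.sqrt (w i) * T i ^ 2)
  have e1 : ∀ i ∈ s, Real.sqrt (w i) * |T i| * (Real.sqrt (w i) * T i ^ 2) = w i * |T i| ^ 3 := by
    intro i hi
    have hs := Real.mul_self_sqrt (hw i hi)
    have h3 : |T i| ^ 3 = |T i| * T i ^ 2 := by rw [← sq_abs (T i)]; ring
    rw [h3]
    calc Real.sqrt (w i) * |T i| * (Real.sqrt (w i) * T i ^ 2)
        = (Real.sqrt (w i) * Real.sqrt (w i)) * (|T i| * T i ^ 2) := by ring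
      _ = _ := by rw [hs]
  have e2 : ∀ i ∈ s, (Real.sqrt (w i) * |T i|) ^ 2 = w i * T i ^ 2 := by
    intro i hi; rw [mul_pow, Real.sq_sqrt (hw i hi), sq_abs]
  have e3 : ∀ i ∈ s, (Real.sqrt (w i) * T i ^ 2) ^ 2 = w i * T i ^ 4 := by
    intro i hi; rw [mul_pow, Real.sq_sqrt (hw i hi)]; ring
  rw [Finset.sum_congr rfl e1, Finset.sum_congr rfl e2, Finset.sum_congr rfl e3] at cs
  exact cs

/-! ### The sign probability -/

/-- The algebra of the fourth-moment method: if `a² ≤ 4 b q` (Cauchy–Schwarz for `E[T₊]`, with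
`a = E|T| = 2E[T₊]`), `b² ≤ a c` (`E[T²]² ≤ E|T| E|T|³`) and `c² ≤ b d` (`E[|T|³]² ≤ E[T²]E[T⁴]`)
with `a, c, d, q ≥ 0` and `b > 0`, then `b² ≤ 4 d q`. [folklore] -/
theorem sq_le_four_mul_of_moments {a b c d q : ℝ} (hb : 0 < b)
    (hd : 0 ≤ d) (h1 : a ^ 2 ≤ 4 * b * q) (h2 : b ^ 2 ≤ a * c)
    (h3 : c ^ 2 ≤ b * d) : b ^ 2 ≤ 4 * d * q := by
  -- `b⁴ ≤ a² c² ≤ a² b d`, so `b³ ≤ a² d ≤ 4 b q d`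
  have h4 : b ^ 4 ≤ a ^ 2 * c ^ 2 := by
    have := pow_le_pow_left₀ (by positivity) h2 2
    calc b ^ 4 = (b ^ 2) ^ 2 := by ring
      _ ≤ (a * c) ^ 2 := this
      _ = a ^ 2 * c ^ 2 := by ring
  have h5 : a ^ 2 * c ^ 2 ≤ a ^ 2 * (b * d) := mul_le_mul_of_nonneg_left h3 (by positivity)
  have h6 : b ^ 3 ≤ a ^ 2 * d := by
    have : b * b ^ 3 ≤ b * (a ^ 2 * d) := by nlinarith
    exact le_of_mul_le_mul_left this hb
  have h7 : a ^ 2 * d ≤ 4 * b * q * d := mul_le_mul_of_nonneg_right h1 hd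
  have h8 : b * b ^ 2 ≤ b * (4 * d * q) := by nlinarith
  exact le_of_mul_le_mul_left h8 hb

/-- **The sign probability of an i.i.d. sum** (fourth-moment method): for a probability weight
`p` on a finite type with `Σ p Y = 0`, `Σ p Y² = v > 0` and `|Y| ≤ K`, and every `m ≥ 1`,
`Σ_{Φ : Fin m → C} (∏ p(Φᵢ)) 1[Σ Y(Φᵢ) ≥ 0] ≥ v / (4 (K² + 3 v))` — uniformly in `m`
(from `P[T ≥ 0] ≥ E[T²]²/(4E[T⁴])`, `E[T²] = mv`, `E[T⁴] ≤ mK²v + 3m²v²`). This replaces the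
CLT step of Achlioptas–Peres' Lemma 7. [cite: AchlioptasPeres2004, Lemma 7 (arXiv:cs/0305009 pp. 15–17), positive-probability form] -/
theorem sum_prod_ite_sum_nonneg_ge {p Y : C → ℝ} (hp0 : ∀ c, 0 ≤ p c) (hp1 : ∑ c, p c = 1)
    (hY1 : ∑ c, p c * Y c = 0) {v K : ℝ} (hv : 0 < v) (hY2 : ∑ c, p c * Y c ^ 2 = v)
    (hK : ∀ c, |Y c| ≤ K) {m : ℕ} (hm : 1 ≤ m) :
    v / (4 * (K ^ 2 + 3 * v)) ≤
      ∑ Φ : Fin m → C, (∏ i, p (Φ i)) * (if 0 ≤ ∑ i, Y (Φ i) then 1 else 0) := by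
  have hw0 : ∀ Φ ∈ (univ : Finset (Fin m → C)), 0 ≤ ∏ i, p (Φ i) :=
    fun Φ _ => Finset.prod_nonneg fun i _ => hp0 _
  -- the three Cauchy–Schwarz inequalities and the mean-zero identity
  have cs1 := sq_sum_mul_posPart_le univ (fun Φ : Fin m → C => ∏ i, p (Φ i))
    (fun Φ => ∑ i, Y (Φ i)) hw0
  have cs2 := sq_sum_mul_sq_le univ (fun Φ : Fin m → C => ∏ i, p (Φ i))
    (fun Φ => ∑ i, Y (Φ i)) hw0
  have cs3 := sq_sum_mul_abs_pow_three_le univ (fun Φ : Fin m → C => ∏ i, p (Φ i))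
    (fun Φ => ∑ i, Y (Φ i)) hw0
  have hmean : ∑ Φ : Fin m → C, (∏ i, p (Φ i)) * (∑ i, Y (Φ i)) = 0 :=
    sum_prod_mul_sum_eq_zero hp1 hY1 m
  have hbv : ∑ Φ : Fin m → C, (∏ i, p (Φ i)) * (∑ i, Y (Φ i)) ^ 2 = m * v :=
    sum_prod_mul_sum_sq hp1 hY1 hY2 m
  have hd4 : ∑ Φ : Fin m → C, (∏ i, p (Φ i)) * (∑ i, Y (Φ i)) ^ 4 =
      m * (∑ c, p c * Y c ^ 4) + 3 * ((m : ℝ) ^ 2 - m) * v ^ 2 :=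
    sum_prod_mul_sum_pow_four hp1 hY1 hY2 rfl m
  beta_reduce at cs1 cs2 cs3
  -- `a = E|T| = 2 E[T 1[T≥0]]` by `E[T] = 0`
  have ha2 : ∑ Φ : Fin m → C, (∏ i, p (Φ i)) * |∑ i, Y (Φ i)| =
      2 * ∑ Φ : Fin m → C, (∏ i, p (Φ i)) *
        ((∑ i, Y (Φ i)) * if 0 ≤ ∑ i, Y (Φ i) then 1 else 0) := by
    have e : ∀ Φ : Fin m → C, (∏ i, p (Φ i)) * |∑ i, Y (Φ i)| =
        2 * ((∏ i, p (Φ i)) * ((∑ i, Y (Φ i)) * if 0 ≤ ∑ i, Y (Φ i) then 1 else 0)) -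
          (∏ i, p (Φ i)) * (∑ i, Y (Φ i)) := by
      intro Φ
      split_ifs with h
      · rw [abs_of_nonneg h]; ring
      · rw [abs_of_neg (not_le.mp h)]; ring
    rw [Finset.sum_congr rfl fun Φ _ => e Φ, Finset.sum_sub_distrib, hmean, sub_zero,
      Finset.mul_sum]
  -- name the five scalars
  set a : ℝ := ∑ Φ : Fin m → C, (∏ i, p (Φ i)) * |∑ i, Y (Φ i)| with ha
  set a' : ℝ := ∑ Φ : Fin m → C, (∏ i, p (Φ i)) *
    ((∑ i, Y (Φ i)) * if 0 ≤ ∑ i, Y (Φ i) then 1 else 0) with ha'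
  set b : ℝ := ∑ Φ : Fin m → C, (∏ i, p (Φ i)) * (∑ i, Y (Φ i)) ^ 2 with hb
  set c : ℝ := ∑ Φ : Fin m → C, (∏ i, p (Φ i)) * |∑ i, Y (Φ i)| ^ 3 with hc
  set d : ℝ := ∑ Φ : Fin m → C, (∏ i, p (Φ i)) * (∑ i, Y (Φ i)) ^ 4 with hd
  set q : ℝ := ∑ Φ : Fin m → C, (∏ i, p (Φ i)) * (if 0 ≤ ∑ i, Y (Φ i) then 1 else 0) with hq
  have hmpos : (0 : ℝ) < m := by exact_mod_cast hm
  have hbpos : 0 < b := by rw [hbv]; positivity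
  have hd0 : 0 ≤ d := Finset.sum_nonneg fun Φ hΦ => mul_nonneg (hw0 Φ hΦ) (by positivity)
  have hq0 : 0 ≤ q := Finset.sum_nonneg fun Φ hΦ => mul_nonneg (hw0 Φ hΦ) (by positivity)
  have h1 : a ^ 2 ≤ 4 * b * q := by
    rw [ha2]
    calc (2 * a') ^ 2 = 4 * a' ^ 2 := by ring
      _ ≤ 4 * (b * q) := mul_le_mul_of_nonneg_left cs1 (by norm_num)
      _ = 4 * b * q := by ring
  have key := sq_le_four_mul_of_moments hbpos hd0 h1 cs2 cs3
  -- `μ₄ ≤ K² v`, hence `d ≤ m K² v + 3 m² v²`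
  have hμ4 : ∑ x, p x * Y x ^ 4 ≤ K ^ 2 * v := by
    rw [← hY2, Finset.mul_sum]
    refine Finset.sum_le_sum fun x _ => ?_
    have hx : Y x ^ 2 ≤ K ^ 2 := by
      rw [← sq_abs]; exact pow_le_pow_left₀ (abs_nonneg _) (hK x) 2
    calc p x * Y x ^ 4 = (p x * Y x ^ 2) * Y x ^ 2 := by ring
      _ ≤ (p x * Y x ^ 2) * K ^ 2 :=
          mul_le_mul_of_nonneg_left hx (mul_nonneg (hp0 x) (sq_nonneg _))
      _ = K ^ 2 * (p x * Y x ^ 2) := by ring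
  have hd' : d ≤ m * (K ^ 2 * v) + 3 * (m : ℝ) ^ 2 * v ^ 2 := by
    rw [hd4]
    nlinarith [sq_nonneg v]
  -- conclude: `q ≥ b²/(4d) ≥ v/(4(K²+3v))`
  rw [hbv] at key
  have hden : 0 < 4 * (K ^ 2 + 3 * v) := by positivity
  rw [div_le_iff₀ hden]
  have h9 : ((m : ℝ) * v) ^ 2 ≤ 4 * (m * (K ^ 2 * v) + 3 * (m : ℝ) ^ 2 * v ^ 2) * q := by
    calc ((m : ℝ) * v) ^ 2 ≤ 4 * d * q := key
      _ ≤ 4 * (m * (K ^ 2 * v) + 3 * (m : ℝ) ^ 2 * v ^ 2) * q := by gcongr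
  have h10 : (m : ℝ) * v ≤ 4 * (K ^ 2 + 3 * m * v) * q := by
    have e : 4 * (m * (K ^ 2 * v) + 3 * (m : ℝ) ^ 2 * v ^ 2) * q =
        (m * v) * (4 * (K ^ 2 + 3 * m * v) * q) := by ring
    rw [e, sq] at h9
    exact le_of_mul_le_mul_left h9 (by positivity)
  have hm1 : (1 : ℝ) ≤ m := by exact_mod_cast hm
  nlinarith [mul_nonneg (sub_nonneg.mpr hm1) (mul_nonneg (sq_nonneg K) hq0)]

end Literature.Probability.Moments

end
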